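import Literature.NumberTheory.EllipticCurves.OggWildThreeLinearProofs
import HarnessLib

/-!
# `Sw_𝔓(V₂ E) = v(disc) - 2` from an Eisenstein rescaling `θ = λ·e²` of the squared roots of
# the `2`-division cubic (Kodaira types `IV` and `II*` at `p = 3`; Silverman *ATAEC* IV.11.1)

`Proofs` file (theorems only, no definitions, no named facts), sequel of
`OggWildThreeLinearProofs` (same seat, bsd.S15), specialising the Galois-side theorem
`swanConductorAt_rationalTate_two_eq_of_eisenstein` to **`θᵢ = λeᵢ²`**:

* `WeierstrassCurve.eisenstein_cubic_ne_zero` — an Eisenstein cubic has no root in the base ring;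
* `WeierstrassCurve.algEquiv_apply_mem_roots` — `Gal(K̄/K)` permutes the roots `eᵢ`;
* `WeierstrassCurve.swanConductorAt_rationalTate_two_eq_of_quadratic` — if for some `λ ∈ Kˣ`
  the monic cubic with roots `λeᵢ²`, i.e. `X³ + c₂X² + c₁X + c₀` with
  `16c₂ = -λ(b₂² - 16b₄)`, `8c₁ = λ²(2b₄² - b₂b₆)`, `16c₀ = -λ³b₆²`, has coefficients in `𝓞 K`
  and is Eisenstein at a place `v` of residue characteristic `3`, then
  `Sw_𝔓(V₂ E) = v(disc(c)) - 2` for every `𝔓 ∣ v`.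

Compared with the linear case two facts about `u = e²` are needed: the `θᵢ` are distinct and an
element of `Gal(F/K)` fixing `θᵢ` fixes `eᵢ`; both reduce to `eᵢ + eⱼ ≠ 0`, which holds because
otherwise `e_k = -b₂/4 ∈ K` and `θ_k = λe_k² ∈ 𝓞 K` (integrally closed) would be a root of the
Eisenstein cubic.  What is left to the curve side for the Kodaira types `IV` (`λ = s/π` at a
model with `v(a₁), v(a₂), v(a₃) ≥ 1`, `v(a₄), v(a₆) ≥ 2`, `v(b₆) = 2`; *ATAEC* pp. 368–370) and
`II*` (`λ = s/π³`, `v(b₆) = 5`) is local algebra at `v` plus `v(disc) - 2 = δ_v`.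

No definitions, no named facts.  All axioms `propext`, `Classical.choice`, `Quot.sound`.

## References

* J. H. Silverman, *Advanced Topics in the Arithmetic of Elliptic Curves*, GTM 151 (1994), proof of
  Thm. IV.11.1 for `p = 3` (PDF pp. 366–371). [SilvermanATAEC1994]
-/

noncomputable section

open scoped Classical NumberField
open Field IsDedekindDomain Polynomial

universe u

namespace WeierstrassCurve

open Literature.NumberTheory.EllipticCurves Literature.NumberTheory.GaloisRepresentations
  IsDedekindDomain.HeightOneSpectrum

/-- **An Eisenstein cubic has no root in the base ring**: if `c₂, c₁, c₀ ∈ 𝔭` (prime) and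
`c₀ ∉ 𝔭²` then `y³ + c₂y² + c₁y + c₀ ≠ 0` for all `y` (a root would lie in `𝔭`, forcing
`c₀ ∈ 𝔭²`). [folklore] -/
theorem eisenstein_cubic_ne_zero {R : Type*} [CommRing R] {p : Ideal R} [p.IsPrime]
    {c₂ c₁ c₀ : R} (hc₂ : c₂ ∈ p) (hc₁ : c₁ ∈ p) (hc₀ : c₀ ∈ p) (hc₀' : c₀ ∉ p ^ 2) (y : R) :
    y ^ 3 + c₂ * y ^ 2 + c₁ * y + c₀ ≠ 0 := by
  intro h
  have hy3 : y ^ 3 ∈ p := by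
    have e : y ^ 3 = -(c₂ * y ^ 2 + c₁ * y + c₀) := by linear_combination h
    rw [e]
    exact p.neg_mem (p.add_mem (p.add_mem (p.mul_mem_right _ hc₂) (p.mul_mem_right _ hc₁)) hc₀)
  have hy : y ∈ p := Ideal.IsPrime.mem_of_pow_mem inferInstance 3 hy3
  apply hc₀'
  have e : c₀ = -(y * (y * y) + c₂ * (y * y) + c₁ * y) := by linear_combination h
  rw [e, pow_two]
  exact Submodule.neg_mem _ (Ideal.add_mem _ (Ideal.add_mem _ (Ideal.mul_mem_mul hy
    (p.mul_mem_left y hy)) (Ideal.mul_mem_mul hc₂ (p.mul_mem_left y hy))) (Ideal.mul_mem_mul hc₁ hy))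

variable {K : Type u} [Field K] [NumberField K] (W : WeierstrassCurve K)

omit [NumberField K] in
/-- An automorphism of `K̄/K` permutes the roots of the `2`-division cubic. [folklore] -/
theorem algEquiv_apply_mem_roots {e₁ e₂ e₃ : AlgebraicClosure K}
    (h3 : (Cubic.map (algebraMap K (AlgebraicClosure K)) W.twoTorsionPolynomial).roots = {e₁, e₂, e₃})
    (σ : AlgebraicClosure K ≃ₐ[K] AlgebraicClosure K) {e : AlgebraicClosure K}
    (he : e = e₁ ∨ e = e₂ ∨ e = e₃) : σ e = e₁ ∨ σ e = e₂ ∨ σ e = e₃ := by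
  have hmem : e ∈ W.twoTorsionPolynomial.toPoly.rootSet (AlgebraicClosure K) := by
    rw [W.rootSet_twoTorsionPolynomial_eq h3]
    rcases he with rfl | rfl | rfl <;> simp
  have := Polynomial.rootSet_mapsTo (σ : AlgebraicClosure K →ₐ[K] AlgebraicClosure K) hmem
  rw [W.rootSet_twoTorsionPolynomial_eq h3] at this
  simpa using this

/-- **`Sw_𝔓(V₂ E) = v(disc) - 2` from an Eisenstein rescaling of the squared roots of the
`2`-division cubic.**  Let `E/K` be an elliptic curve over a number field, `v ∣ 3` a finite place,
`𝔓 ∣ v`, and suppose that for some `λ ∈ Kˣ` the monic cubic with roots `θᵢ = λeᵢ²` (`eᵢ` the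
roots of `x³ + (b₂/4)x² + (b₄/2)x + b₆/4`), namely `X³ + c₂X² + c₁X + c₀` with
`16c₂ = -λ(b₂² - 16b₄)`, `8c₁ = λ²(2b₄² - b₂b₆)`, `16c₀ = -λ³b₆²`, has coefficients in `𝓞 K`
and is **Eisenstein at `v`**.  Then `Sw_𝔓(V₂ E) = v(disc) - 2`.  This covers the Kodaira types
`IV` (`λ = s/π`: `v(a₂) ≥ 1, v(a₄) ≥ 2, v(a₆) = 2`, *ATAEC* pp. 369–370, where Silverman uses
`π_L = π_M/α` with `v(α) = 2/3` — equivalently `α²/π_M`, of valuation `1/3`) and `II*`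
(`λ = s/π³`: `v(a₂) ≥ 2, v(a₄) ≥ 4, v(a₆) = 5`).  The extra input compared with the linear case
is that an Eisenstein cubic has no root in `𝓞 K` (`eisenstein_cubic_ne_zero`), which rules out
`eᵢ = -eⱼ` (else `e_k = -b₂/4 ∈ K` and `θ_k ∈ 𝓞 K` would be a root) and makes the `θᵢ` distinct
and the `eᵢ` recoverable from the `θᵢ` up to the Galois action.
[cite: SilvermanATAEC1994, proof of Thm. IV.11.1 for p = 3 (PDF pp. 366–371)] -/
theorem swanConductorAt_rationalTate_two_eq_of_quadratic [W.IsElliptic]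
    (h : Continuous fun x : absoluteGaloisGroup K × RationalTateModule (geomPoints W) 2 ↦
      rationalTateRepresentation (absoluteGaloisGroup K) (geomPoints W) 2 x.1 x.2)
    {v : HeightOneSpectrum (𝓞 K)} (hv3 : ringChar (𝓞 K ⧸ v.asIdeal) = 3)
    {𝔓 : Ideal (absIntegers (𝓞 K) K)} (h𝔓 : 𝔓 ∈ v.primesAbove)
    (lam : K) (hlam : lam ≠ 0) {c₂ c₁ c₀ : 𝓞 K}
    (hc₂ : (c₂ : K) * 16 = -lam * (W.b₂ ^ 2 - 16 * W.b₄))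
    (hc₁ : (c₁ : K) * 8 = lam ^ 2 * (2 * W.b₄ ^ 2 - W.b₂ * W.b₆))
    (hc₀ : (c₀ : K) * 16 = -lam ^ 3 * W.b₆ ^ 2)
    (hv₂ : c₂ ∈ v.asIdeal) (hv₁ : c₁ ∈ v.asIdeal) (hv₀ : c₀ ∈ v.asIdeal) (hv₀' : c₀ ∉ v.asIdeal ^ 2)
    {n : ℕ} (hn : ord v.asIdeal (c₂ ^ 2 * c₁ ^ 2 - 4 * c₁ ^ 3 - 4 * c₂ ^ 3 * c₀ - 27 * c₀ ^ 2 +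
      18 * c₂ * c₁ * c₀) = n) :
    (rationalTateGaloisRepOf (geomPoints W) 2 h).swanConductorAt (𝓞 K) 𝔓 = ((n - 2 : ℕ) : ℝ) := by
  -- the roots `eᵢ` of the `2`-division cubic
  set φ := algebraMap K (AlgebraicClosure K) with hφ
  have ha : W.twoTorsionPolynomial.a ≠ 0 := by
    show (4 : K) ≠ 0
    norm_num
  have hsplit : (W.twoTorsionPolynomial.toPoly.map φ).Splits := IsAlgClosed.splits _
  obtain ⟨e₁, e₂, e₃, h3⟩ := (Cubic.splits_iff_roots_eq_three ha).mp hsplit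
  have hdisc : W.twoTorsionPolynomial.discr ≠ 0 := by
    rw [twoTorsionPolynomial_discr]
    exact mul_ne_zero (by norm_num) W.isUnit_Δ.ne_zero
  obtain ⟨h12, h13, h23⟩ := (Cubic.discr_ne_zero_iff_roots_ne ha h3).mp hdisc
  have hsum : 4 * (e₁ + e₂ + e₃) = -φ W.b₂ := by
    have hb := Cubic.b_eq_three_roots ha h3
    simp only [twoTorsionPolynomial, map_ofNat] at hb
    linear_combination hb
  have hsum2 : 4 * (e₁ * e₂ + e₁ * e₃ + e₂ * e₃) = 2 * φ W.b₄ := by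
    have hc := Cubic.c_eq_three_roots ha h3
    simp only [twoTorsionPolynomial, map_ofNat, map_mul] at hc
    linear_combination (-1 : AlgebraicClosure K) * hc
  have hprod : 4 * (e₁ * e₂ * e₃) = -φ W.b₆ := by
    have hd := Cubic.d_eq_three_roots ha h3
    simp only [twoTorsionPolynomial, map_ofNat] at hd
    linear_combination hd
  have cancel : ∀ {m : ℕ} {x y : AlgebraicClosure K}, m ≠ 0 → (m : AlgebraicClosure K) * x = m * y →
      x = y := fun hm hxy ↦ mul_left_cancel₀ (by exact_mod_cast hm) hxy
  -- symmetric functions of the `uᵢ = eᵢ²`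
  have hu1 : 16 * (e₁ ^ 2 + e₂ ^ 2 + e₃ ^ 2) = φ W.b₂ ^ 2 - 16 * φ W.b₄ := by
    linear_combination (4 * (e₁ + e₂ + e₃) - φ W.b₂) * hsum - 8 * hsum2
  have hu2 : 16 * (e₁ ^ 2 * e₂ ^ 2 + e₁ ^ 2 * e₃ ^ 2 + e₂ ^ 2 * e₃ ^ 2) =
      4 * φ W.b₄ ^ 2 - 2 * φ W.b₂ * φ W.b₆ := by
    linear_combination (4 * (e₁ * e₂ + e₁ * e₃ + e₂ * e₃) + 2 * φ W.b₄) * hsum2 -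
      (2 * (4 * (e₁ + e₂ + e₃))) * hprod + (2 * φ W.b₆) * hsum
  have hu3 : 16 * (e₁ ^ 2 * e₂ ^ 2 * e₃ ^ 2) = φ W.b₆ ^ 2 := by
    linear_combination (4 * (e₁ * e₂ * e₃) - φ W.b₆) * hprod
  -- the `2`-division field `F = K(e₁, e₂, e₃)`
  set Q : K[X] := W.twoTorsionPolynomial.toPoly with hQ
  set F : IntermediateField K (AlgebraicClosure K) :=
    IntermediateField.adjoin K (Q.rootSet (AlgebraicClosure K)) with hF
  haveI hsf : Q.IsSplittingField K F :=
    IntermediateField.adjoin_rootSet_isSplittingField (IsAlgClosed.splits _)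
  haveI hN : Normal K F := Normal.of_isSplittingField Q
  haveI hFD : FiniteDimensional K F := Polynomial.IsSplittingField.finiteDimensional F Q
  haveI : IsGalois K F := IsGalois.mk
  have hRS := W.rootSet_twoTorsionPolynomial_eq h3
  have he₁ : e₁ ∈ F := IntermediateField.subset_adjoin K _ (by rw [hRS]; simp)
  have he₂ : e₂ ∈ F := IntermediateField.subset_adjoin K _ (by rw [hRS]; simp)
  have he₃ : e₃ ∈ F := IntermediateField.subset_adjoin K _ (by rw [hRS]; simp)
  have hFgen : ∀ g : F ≃ₐ[K] F, g ⟨e₁, he₁⟩ = ⟨e₁, he₁⟩ → g ⟨e₂, he₂⟩ = ⟨e₂, he₂⟩ →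
      g ⟨e₃, he₃⟩ = ⟨e₃, he₃⟩ → g = 1 :=
    fun g ↦ W.algEquiv_eq_one_of_apply_roots_eq h3 hF he₁ he₂ he₃ g
  -- the integers `θᵢ = λ eᵢ²`
  have hev : ∀ {e : AlgebraicClosure K}, (e = e₁ ∨ e = e₂ ∨ e = e₃) →
      4 * e ^ 3 + φ W.b₂ * e ^ 2 + 2 * φ W.b₄ * e + φ W.b₆ = 0 :=
    fun hor ↦ eval_eq_zero_of_roots_eq h3 hor
  have hc₂' : φ c₂ * 16 = -φ lam * (φ W.b₂ ^ 2 - 16 * φ W.b₄) := by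
    have := congrArg φ hc₂
    simp only [map_mul, map_ofNat, map_neg, map_sub, map_pow] at this
    exact this
  have hc₁' : φ c₁ * 8 = φ lam ^ 2 * (2 * φ W.b₄ ^ 2 - φ W.b₂ * φ W.b₆) := by
    have := congrArg φ hc₁
    simp only [map_mul, map_ofNat, map_sub, map_pow] at this
    exact this
  have hc₀' : φ c₀ * 16 = -φ lam ^ 3 * φ W.b₆ ^ 2 := by
    have := congrArg φ hc₀
    simp only [map_mul, map_ofNat, map_neg, map_pow] at this
    exact this
  have hθroot : ∀ {e : AlgebraicClosure K}, (e = e₁ ∨ e = e₂ ∨ e = e₃) →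
      (φ lam * e ^ 2) ^ 3 + φ c₂ * (φ lam * e ^ 2) ^ 2 + φ c₁ * (φ lam * e ^ 2) + φ c₀ = 0 := by
    intro e hor
    apply cancel (m := 64) (by norm_num)
    rw [mul_zero]
    push_cast
    linear_combination (4 * φ lam ^ 2 * e ^ 4) * hc₂' + (8 * φ lam * e ^ 2) * hc₁' + 4 * hc₀' +
      (4 * φ lam ^ 3 * (4 * e ^ 3 - φ W.b₂ * e ^ 2 + 2 * φ W.b₄ * e - φ W.b₆)) * hev hor
  have hmemF : ∀ {e : AlgebraicClosure K}, e ∈ F → φ lam * e ^ 2 ∈ F :=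
    fun he ↦ mul_mem (IntermediateField.algebraMap_mem F lam) (pow_mem he 2)
  have hintK : ∀ {e : AlgebraicClosure K}, (e = e₁ ∨ e = e₂ ∨ e = e₃) →
      _root_.IsIntegral (𝓞 K) (φ lam * e ^ 2) := by
    intro e hor
    refine ⟨Cubic.toPoly ⟨1, c₂, c₁, c₀⟩, Cubic.monic_of_a_eq_one rfl, ?_⟩
    change Polynomial.eval₂ (algebraMap (𝓞 K) (AlgebraicClosure K)) (φ lam * e ^ 2) _ = 0
    simp only [Cubic.toPoly, eval₂_add, eval₂_mul, eval₂_C, eval₂_pow, eval₂_X, map_one, one_mul]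
    have hK : ∀ c : 𝓞 K, algebraMap (𝓞 K) (AlgebraicClosure K) c = φ c := fun c ↦ rfl
    rw [hK, hK, hK]
    exact hθroot hor
  have hint : ∀ {e : AlgebraicClosure K} (he : e ∈ F), (e = e₁ ∨ e = e₂ ∨ e = e₃) →
      _root_.IsIntegral (𝓞 K) (⟨φ lam * e ^ 2, hmemF he⟩ : F) := by
    intro e he hor
    obtain ⟨p, hp, hp0⟩ := hintK hor
    refine ⟨p, hp, ?_⟩
    apply (algebraMap F (AlgebraicClosure K)).injective
    rw [Polynomial.hom_eval₂, map_zero]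
    exact hp0
  -- **no root of the Eisenstein cubic in `𝓞 K`**, hence `eᵢ + eⱼ ≠ 0`
  haveI : v.asIdeal.IsPrime := v.isPrime
  have hnoroot : ∀ {e : AlgebraicClosure K}, (e = e₁ ∨ e = e₂ ∨ e = e₃) →
      ∀ x : K, φ x ≠ e := by
    intro e hor x hx
    -- `θ = λ x²` is an integral element of `K`, hence in `𝓞 K`, and a root
    have hθint : _root_.IsIntegral (𝓞 K) (lam * x ^ 2) := by
      have h1 := hintK hor
      rw [← hx, ← map_pow, ← map_mul] at h1
      exact (isIntegral_algHom_iff (IsScalarTower.toAlgHom (𝓞 K) K (AlgebraicClosure K))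
        (algebraMap K (AlgebraicClosure K)).injective).mp h1
    obtain ⟨y, hy⟩ := (IsIntegrallyClosed.isIntegral_iff (R := 𝓞 K) (K := K)).mp hθint
    apply eisenstein_cubic_ne_zero hv₂ hv₁ hv₀ hv₀' y
    apply IsFractionRing.injective (𝓞 K) K
    apply φ.injective
    rw [map_zero, map_zero]
    have hθ := hθroot hor
    rw [← hx, ← map_pow, ← map_mul, ← show (algebraMap (𝓞 K) K y) = lam * x ^ 2 from hy] at hθ
    simpa [map_add, map_mul, map_pow] using hθ
  have hsumne : ∀ {x y z : AlgebraicClosure K}, 4 * (x + y + z) = -φ W.b₂ →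
      (z = e₁ ∨ z = e₂ ∨ z = e₃) → x + y ≠ 0 := by
    intro x y z hxyz hz hxy
    refine hnoroot hz (-W.b₂ / 4) ?_
    rw [map_div₀, map_neg, map_ofNat]
    apply cancel (m := 4) (by norm_num)
    push_cast
    rw [mul_div_cancel₀ _ (by norm_num : (4 : AlgebraicClosure K) ≠ 0)]
    linear_combination (-1 : AlgebraicClosure K) * hxyz + 4 * hxy
  have h12' : e₁ + e₂ ≠ 0 := hsumne hsum (Or.inr (Or.inr rfl))
  have h13' : e₁ + e₃ ≠ 0 := hsumne (by linear_combination hsum) (Or.inr (Or.inl rfl))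
  have h23' : e₂ + e₃ ≠ 0 := hsumne (by linear_combination hsum) (Or.inl rfl)
  have hsqne : ∀ {x y : AlgebraicClosure K}, x ≠ y → x + y ≠ 0 → x ^ 2 ≠ y ^ 2 := by
    intro x y hxy hxy' hsq
    have : (x - y) * (x + y) = 0 := by linear_combination hsq
    rcases mul_eq_zero.mp this with h0 | h0
    · exact hxy (sub_eq_zero.mp h0)
    · exact hxy' h0
  set θ₁ : integralClosure (𝓞 K) F := ⟨⟨φ lam * e₁ ^ 2, hmemF he₁⟩, hint he₁ (Or.inl rfl)⟩ with hθ₁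
  set θ₂ : integralClosure (𝓞 K) F :=
    ⟨⟨φ lam * e₂ ^ 2, hmemF he₂⟩, hint he₂ (Or.inr (Or.inl rfl))⟩ with hθ₂
  set θ₃ : integralClosure (𝓞 K) F :=
    ⟨⟨φ lam * e₃ ^ 2, hmemF he₃⟩, hint he₃ (Or.inr (Or.inr rfl))⟩ with hθ₃
  have hcoe : ∀ c : 𝓞 K, (((algebraMap (𝓞 K) (integralClosure (𝓞 K) F) c :
      integralClosure (𝓞 K) F) : F) : AlgebraicClosure K) = φ c := fun c ↦ rfl
  have hlam' : φ lam ≠ 0 := (map_ne_zero φ).mpr hlam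
  -- Vieta, distinctness, `θ`'s determine `e`'s
  have hV₁ : θ₁ + θ₂ + θ₃ = -algebraMap (𝓞 K) _ c₂ := by
    apply Subtype.ext; apply Subtype.ext
    change φ lam * e₁ ^ 2 + φ lam * e₂ ^ 2 + φ lam * e₃ ^ 2 = -((((algebraMap (𝓞 K)
      (integralClosure (𝓞 K) F) c₂ : integralClosure (𝓞 K) F) : F) : AlgebraicClosure K))
    rw [hcoe]
    apply cancel (m := 16) (by norm_num)
    push_cast
    linear_combination (φ lam) * hu1 + hc₂'
  have hV₂ : θ₁ * θ₂ + θ₁ * θ₃ + θ₂ * θ₃ = algebraMap (𝓞 K) _ c₁ := by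
    apply Subtype.ext; apply Subtype.ext
    change φ lam * e₁ ^ 2 * (φ lam * e₂ ^ 2) + φ lam * e₁ ^ 2 * (φ lam * e₃ ^ 2) +
      φ lam * e₂ ^ 2 * (φ lam * e₃ ^ 2) =
      (((algebraMap (𝓞 K) (integralClosure (𝓞 K) F) c₁ : integralClosure (𝓞 K) F) : F) :
        AlgebraicClosure K)
    rw [hcoe]
    apply cancel (m := 16) (by norm_num)
    push_cast
    linear_combination (φ lam ^ 2) * hu2 - 2 * hc₁'
  have hV₃ : θ₁ * θ₂ * θ₃ = -algebraMap (𝓞 K) _ c₀ := by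
    apply Subtype.ext; apply Subtype.ext
    change φ lam * e₁ ^ 2 * (φ lam * e₂ ^ 2) * (φ lam * e₃ ^ 2) = -((((algebraMap (𝓞 K)
      (integralClosure (𝓞 K) F) c₀ : integralClosure (𝓞 K) F) : F) : AlgebraicClosure K))
    rw [hcoe]
    apply cancel (m := 16) (by norm_num)
    push_cast
    linear_combination (φ lam ^ 3) * hu3 + hc₀'
  have hne : ∀ {x y : AlgebraicClosure K} (hx : x ∈ F) (hy : y ∈ F) (ix : _root_.IsIntegral (𝓞 K)
      (⟨φ lam * x ^ 2, hmemF hx⟩ : F)) (iy : _root_.IsIntegral (𝓞 K) (⟨φ lam * y ^ 2, hmemF hy⟩ : F)),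
      x ^ 2 ≠ y ^ 2 →
      (⟨⟨φ lam * x ^ 2, hmemF hx⟩, ix⟩ : integralClosure (𝓞 K) F) ≠
        ⟨⟨φ lam * y ^ 2, hmemF hy⟩, iy⟩ := by
    intro x y hx hy ix iy hxy heq
    have := congrArg (fun t : integralClosure (𝓞 K) F ↦ ((t : F) : AlgebraicClosure K)) heq
    exact hxy (mul_left_cancel₀ hlam' this)
  have hres : ∀ (σ : absoluteGaloisGroup K) (x : F),
      ((absRestrictNormalHom F σ x : F) : AlgebraicClosure K) = σ • (x : AlgebraicClosure K) :=
    fun σ x ↦ AlgEquiv.restrictNormal_commutes (absoluteGaloisGroup.toAlgEquiv K σ) F x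
  have hθe : ∀ g : F ≃ₐ[K] F, g • θ₁ = θ₁ → g • θ₂ = θ₂ → g • θ₃ = θ₃ →
      g ⟨e₁, he₁⟩ = ⟨e₁, he₁⟩ ∧ g ⟨e₂, he₂⟩ = ⟨e₂, he₂⟩ ∧ g ⟨e₃, he₃⟩ = ⟨e₃, he₃⟩ := by
    have key : ∀ {e : AlgebraicClosure K} (he : e ∈ F) (hor : e = e₁ ∨ e = e₂ ∨ e = e₃)
        (ie : _root_.IsIntegral (𝓞 K) (⟨φ lam * e ^ 2, hmemF he⟩ : F)) (g : F ≃ₐ[K] F),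
        g • (⟨⟨φ lam * e ^ 2, hmemF he⟩, ie⟩ : integralClosure (𝓞 K) F) =
          ⟨⟨φ lam * e ^ 2, hmemF he⟩, ie⟩ → g ⟨e, he⟩ = ⟨e, he⟩ := by
      intro e he hor ie g hg
      have hg' := congrArg (fun t : integralClosure (𝓞 K) F ↦ ((t : F) : AlgebraicClosure K)) hg
      -- lift `g` to `σ ∈ Γ_K`
      obtain ⟨σ, hσ⟩ := absRestrictNormalHom_surjective' F g
      have hge : ((g ⟨e, he⟩ : F) : AlgebraicClosure K) = σ • e := by rw [← hσ, hres]
      have hgθ : ((g ⟨φ lam * e ^ 2, hmemF he⟩ : F) : AlgebraicClosure K) = σ • (φ lam * e ^ 2) := by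
        rw [← hσ, hres]
      change ((g ⟨φ lam * e ^ 2, hmemF he⟩ : F) : AlgebraicClosure K) = φ lam * e ^ 2 at hg'
      rw [hgθ, smul_mul', smul_pow', smul_algebraMap] at hg'
      have hsq : (σ • e) ^ 2 = e ^ 2 := mul_left_cancel₀ hlam' hg'
      -- `σ e` is a root, and `σ e = ± e`
      have hroot : σ • e = e₁ ∨ σ • e = e₂ ∨ σ • e = e₃ :=
        W.algEquiv_apply_mem_roots h3 (absoluteGaloisGroup.toAlgEquiv K σ) hor
      have hpm : σ • e = e ∨ σ • e = -e := by
        have : (σ • e - e) * (σ • e + e) = 0 := by linear_combination hsq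
        rcases mul_eq_zero.mp this with h0 | h0
        · exact Or.inl (sub_eq_zero.mp h0)
        · exact Or.inr (eq_neg_of_add_eq_zero_left h0)
      apply Subtype.ext
      rw [hge]
      rcases hpm with hfix | hneg
      · exact hfix
      · -- `σ e = -e` is a root `e'`; `e + e' = 0` is excluded unless `e' = e`
        rw [hneg] at hroot ⊢
        rcases hor with rfl | rfl | rfl
        · rcases hroot with h' | h' | h'
          · exact h'
          · exact absurd (by linear_combination -h') h12'
          · exact absurd (by linear_combination -h') h13'
        · rcases hroot with h' | h' | h'
          · exact absurd (by linear_combination -h') h12'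
          · exact h'
          · exact absurd (by linear_combination -h') h23'
        · rcases hroot with h' | h' | h'
          · exact absurd (by linear_combination -h') h13'
          · exact absurd (by linear_combination -h') h23'
          · exact h'
    intro g g1 g2 g3
    exact ⟨key he₁ (Or.inl rfl) _ g g1, key he₂ (Or.inr (Or.inl rfl)) _ g g2,
      key he₃ (Or.inr (Or.inr rfl)) _ g g3⟩
  exact W.swanConductorAt_rationalTate_two_eq_of_eisenstein h hv3 h𝔓 F h3 he₁ he₂ he₃ hFgen hV₁ hV₂ hV₃
    hv₂ hv₁ hv₀ hv₀' (hne he₁ he₂ _ _ (hsqne h12 h12')) (hne he₁ he₃ _ _ (hsqne h13 h13'))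
    (hne he₂ he₃ _ _ (hsqne h23 h23')) hθe hn

end WeierstrassCurve

end
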